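import Summits.QuantumAdvantage.QuantumAdvantage.Theses.ArithStatLadder
import Literature.Computability.Cryptography.HallgrenClassGroup
import Literature.NumberTheory.QuadraticFields.ThreeTorsion
import Literature.Computability.Complexity.PPolyReductions
import Literature.Computability.Complexity.PPolyComplement
import Literature.Probability.RandomGraphs.LowDegree

/-!
# Sketch (crux-ideate, stmt-QuantumAdvantage-2422 `IqThreeNotPPoly`, round 1, ideator k = 2)

First lemmas of the two idea cards of this seat, stated over existing declarations:

* Card `sqfree-filter-domination`: `SQFREE ≤ IQ3` by a one-sided randomized reduction through
  binary cubic forms with a PLANTED DOUBLE ROOT modulo `m` (so `m ∣ Disc`), hence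
  `SqfreeNotPPoly → IqThreeNotPPoly`.  Kernel-checked here: the arithmetic core
  `m ∣ Disc((x − r y)²(a x − s y) + m·g)` (`dvd_bdisc_doubleRoot`) and the composition
  `iqThreeNotPPoly_of_sqfree`; the two genuine stubs are `ClosureStub` (P/poly is closed under
  one-sided randomized poly-time many-one reductions — Adleman) and `SieveStub` (the planted
  double-root sampler hits negative fundamental discriminants with probability ≥ 1/poly when `m` is
  squarefree; Davenport–Heilbronn/BST sieve + Hasse's "cubic field of fundamental discriminant D ⇒
  3 ∣ h(D)").
* Card `exact-decider-top-rung`: the P/poly correlation rung `PPolyRung` (top of the route's ladder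
  EndJuntaRung ⊂ DigitRung ⊂ AcZeroRung ⊂ …) implies the PROMISE core of the crux and hence the crux,
  with NO density side condition, because an exact decider has correlation `E|t − 2| ≥ 1`
  (`one_le_abs_pow_three_sub_two`).
-/

noncomputable section

set_option linter.dupNamespace false

open scoped Classical BigOperators

namespace Summit.QuantumAdvantage.QuantumAdvantage.Cruxes.IqThreeNotPPoly.SketchIdeator2

open _root_.Computability Literature.Computability.Complexity
open Literature.Computability.Cryptography
open Literature.NumberTheory.QuadraticFields
open Literature.Probability.RandomGraphs.LowDegree
open Summit.QuantumAdvantage.QuantumAdvantage.Theses.ArithStatLadder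
open Filter

/-! ## Reading of the crux (verbatim copies of `Cruxes/IqThreeNotPPoly/Disproof.lean` §0/§3, which is
not yet built on the farm; same names, same bodies) -/

/-- The set `S = {d : −d fundamental, 3 ∣ h(−d)}` of the crux. -/
def iqThreeSet : Set ℕ :=
  {d | IsNegFundamentalDiscr d ∧ 3 ∣ BinaryQuadraticForm.classNumber (-(d : ℤ))}

/-- `IQ3 = bin(S)`. -/
def iqThreeLang : Language Bool := encodingNatBool.toLanguage iqThreeSet

/-- The crux is literally `IQ3 ∉ P/poly`. -/
theorem iqThreeNotPPoly_iff : IqThreeNotPPoly ↔ iqThreeLang ∉ PPoly := Iff.rfl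

/-- Membership of an encoded number. -/
theorem encodeNat_mem_iff (d : ℕ) : encodeNat d ∈ iqThreeLang ↔ d ∈ iqThreeSet :=
  encodingNatBool.mem_toLanguage_iff iqThreeSet d

/-- Primes `≡ 3 (mod 4)`. -/
def primes34Set : Set ℕ := {p | p.Prime ∧ p % 4 = 3}

/-- The disprover's prime core `IQ3′ = bin {p prime, p ≡ 3 (4), 3 ∣ h(−p)} ∉ P/poly`. -/
def PrimeIqThreeNotPPoly : Prop :=
  encodingNatBool.toLanguage {p | p.Prime ∧ p % 4 = 3 ∧ 3 ∣ BinaryQuadraticForm.classNumber (-(p : ℤ))} ∉ PPoly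

/-! ## Card A — `sqfree-filter-domination` -/

/-- The squarefree numbers. -/
def sqfreeSet : Set ℕ := {m | Squarefree m}

/-- `SQFREE = bin {m : m squarefree}` (LSB-first `encodeNat`, as the crux). -/
def sqfreeLang : Language Bool := encodingNatBool.toLanguage sqfreeSet

/-- Hypothesis-type stub of the line (factoring family): squarefreeness has no polynomial-size
circuits. Implies `FACT ∉ FP/poly`; believed (Adleman–McCurley open problem; the `p²q`-vs-`pq`
indistinguishability behind Okamoto–Uchiyama / ESIGN). -/
def SqfreeNotPPoly : Prop := sqfreeLang ∉ PPoly

/-- Discriminant of the binary cubic form `a x³ + b x²y + c xy² + d y³`. -/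
def bdisc (a b c d : ℤ) : ℤ :=
  b ^ 2 * c ^ 2 - 4 * a * c ^ 3 - 4 * b ^ 3 * d - 27 * a ^ 2 * d ^ 2 + 18 * a * b * c * d

/-- A form with a double root has discriminant `0`:
`(x − r y)²(a x − s y) = a x³ + (−s − 2ar) x²y + (2rs + ar²) xy² + (−r²s) y³`. -/
theorem bdisc_doubleRoot (a r s : ℤ) :
    bdisc a (-s - 2 * a * r) (2 * r * s + a * r ^ 2) (-(r ^ 2 * s)) = 0 := by
  unfold bdisc; ring

/-- **Arithmetic core of the reduction**: perturbing the double-root form by `m·g` keeps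
`m ∣ Disc` — without knowing the factorisation of `m`. -/
theorem dvd_bdisc_doubleRoot (m : ℕ) (a r s g₀ g₁ g₂ g₃ : ℤ) :
    (m : ℤ) ∣ bdisc (a + m * g₀) (-s - 2 * a * r + m * g₁) (2 * r * s + a * r ^ 2 + m * g₂)
      (-(r ^ 2 * s) + m * g₃) := by
  rw [← ZMod.intCast_zmod_eq_zero_iff_dvd]
  unfold bdisc
  push_cast
  simp only [ZMod.natCast_self, zero_mul, add_zero]
  ring

/-- If `m ∣ D` and the odd part of `m` is not squarefree then `D` is not squarefree; this is the
one-sidedness of the reduction at odd primes (the prime `2` is handled by `v₂(m) ≤ 3`). -/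
theorem not_squarefree_of_dvd {m D : ℤ} (hmD : m ∣ D) (hm : ¬ Squarefree m) : ¬ Squarefree D :=
  fun hD => hm (hD.squarefree_of_dvd hmD)

/-- One-sided randomized polynomial-time many-one reducibility of number sets (abstract interface
of the line; seeds `ρ ∈ {0,1}^{q(n)}`): NO-instances never map into `B`, YES-instances map into `B`
for at least a `1/q(n)` fraction of the seeds. -/
def OneSidedRReducible (A B : Set ℕ) : Prop :=
  ∃ S : List Bool → List Bool, S ∈ FP ∧ ∃ q : Polynomial ℕ,
    (∀ m : ℕ, m ∉ A → ∀ ρ : List Bool, decodeNat (S (boolPair (encodeNat m) ρ)) ∉ B) ∧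
    (∀ m : ℕ, m ∈ A →
      2 ^ (q.eval (encodeNat m).length) ≤ q.eval (encodeNat m).length *
        (Finset.univ.filter (fun ρ : Fin (q.eval (encodeNat m).length) → Bool =>
          decodeNat (S (boolPair (encodeNat m) (List.ofFn ρ))) ∈ B)).card)

/-- STUB (provable, Adleman 1978 relativised: amplify to error `< 2^{-n-1}`, union bound over the
inputs of length `n`, hard-wire the good seed tuple; circuit for `B` composed with the `FP` sampler):
`P/poly` is closed downwards under one-sided randomized reductions. -/
def ClosureStub : Prop :=
  ∀ A B : Set ℕ, OneSidedRReducible A B →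
    encodingNatBool.toLanguage B ∈ PPoly → encodingNatBool.toLanguage A ∈ PPoly

/-- STUB (the sieve lemma + Hasse's easy direction): the planted double-root sampler
`m ↦ |Disc((x − r y)²(a x − s y) + m g)|` (with `r s a` random mod `m`, `g` random in a box of side
`m^{O(1)}`, output `0` when `Disc ≥ 0` or `4 ∣ m` — a squarefree `m` has `v₂(m) ≤ 1`, while `4·odd`, `8·odd` do
divide fundamental discriminants) is a one-sided randomized reduction from SQFREE to
the crux's set `S = {d : −d fundamental, 3 ∣ h(−d)}`: `m ∣ Disc` always (`dvd_bdisc_doubleRoot`), so a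
non-squarefree `m` never yields a fundamental `−d`; a squarefree `m` yields a NEGATIVE FUNDAMENTAL
`Disc` with probability `≫ φ(m)/m ≫ 1/log log m` (BST-type squarefree sieve for discriminants of
binary cubic forms in a coset mod `m`), and then `3 ∣ h(Disc)` AUTOMATICALLY (irreducible cubic form of
fundamental discriminant `D` = cubic field of discriminant `D` ⇒ unramified `C₃` over `ℚ(√D)` ⇒
`3 ∣ h(D)`: Hasse 1930 / BST §8.5 / tree dictionary `ThreeTorsionBridge`). -/
def SieveStub : Prop := OneSidedRReducible sqfreeSet iqThreeSet

/-- **Composition (kernel-checked): the line concludes the crux BY NAME.**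
`ClosureStub → SieveStub → SqfreeNotPPoly → IqThreeNotPPoly`. -/
theorem iqThreeNotPPoly_of_sqfree (hC : ClosureStub) (hS : SieveStub) (hQ : SqfreeNotPPoly) :
    IqThreeNotPPoly := by
  rw [iqThreeNotPPoly_iff]
  intro hIQ3
  exact hQ (hC sqfreeSet iqThreeSet hS hIQ3)

/-- Contrapositive reading for refuters: any refutation of the crux puts SQUAREFREENESS in `P/poly`. -/
theorem sqfree_mem_PPoly_of_not (hC : ClosureStub) (hS : SieveStub) (h : ¬ IqThreeNotPPoly) :
    sqfreeLang ∈ PPoly := by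
  by_contra hQ
  exact h (iqThreeNotPPoly_of_sqfree hC hS hQ)

/-! ## Card C — `exact-decider-top-rung` -/

/-- The block `𝒟_n` of `n`-bit `d` with `−d` fundamental (as in the route's rungs). -/
def negFundBlock (n : ℕ) : Finset ℕ :=
  (Finset.Ico (2 ^ (n - 1)) (2 ^ n)).filter (fun d : ℕ => IsNegFundamentalDiscr d)

/-- **The P/poly rung** (top of the ladder EndJuntaRung ⊂ DigitRung ⊂ AcZeroRung ⊂ …; same
`t`-device, same centring `t − 2`, same ensemble; test class = all `B₂`-circuits of polynomial size):
hypothesis-type (separation strength), the natural C⁺ of the crux. -/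
def PPolyRung : Prop :=
  ∀ t : ℤ → ℕ, (∀ (D : ℤ) (K : Type) [Field K] [NumberField K], Module.finrank ℚ K = 2 →
      NumberField.discr K = D → t D = Nat.card {c : ClassGroup (NumberField.RingOfIntegers K) // c ^ 3 = 1}) →
    ∀ p : Polynomial ℕ, ∀ ε : ℝ, 0 < ε → ∀ᶠ n : ℕ in atTop, ∀ C : Circuit (Fin n),
      C.IsOver B2 → C.size ≤ p.eval n →
        |∑ d ∈ negFundBlock n, ((t (-(d : ℤ)) : ℝ) - 2) *
            sgn (C.eval (fun i : Fin n => Nat.testBit d i))| ≤ ε * ((negFundBlock n).card : ℝ)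

/-- **The promise core of the crux** (factoring-independent: squarefreeness is promised): no
polynomial-size circuit family computes `[3 ∣ h(−d)]` correctly on every fundamental `−d`. -/
def PromiseIqThreeNotPPoly : Prop :=
  ¬ ∃ p : Polynomial ℕ, ∃ C : CircuitFamily, (∀ n, (C n).IsOver B2 ∧ (C n).size ≤ p.eval n) ∧
    ∀ d : ℕ, IsNegFundamentalDiscr d →
      (C (encodeNat d).length).eval (encodeNat d).get =
        decide (3 ∣ BinaryQuadraticForm.classNumber (-(d : ℤ)))

/-- The pointwise gap that makes the top rung DENSITY-FREE for the worst-case crux: `t = 3^r` never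
equals its Davenport–Heilbronn mean `2`, so an exact decider has correlation `E|t − 2| ≥ 1`. -/
theorem one_le_abs_pow_three_sub_two (r : ℕ) : (1 : ℝ) ≤ |(3 : ℝ) ^ r - 2| := by
  rcases Nat.eq_zero_or_pos r with rfl | hr
  · norm_num
  · have h3 : (3 : ℝ) ≤ (3 : ℝ) ^ r := by
      calc (3 : ℝ) = 3 ^ 1 := by norm_num
        _ ≤ 3 ^ r := pow_le_pow_right₀ (by norm_num) hr
    rw [abs_of_nonneg (by linarith)]
    linarith

/-- Promise hardness implies the crux (a language decider is in particular a promise decider):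
PROVABLE NOW (unfold `Decides`, `boolIndicator`, membership of `encodeNat d`). -/
theorem iqThreeNotPPoly_of_promise (h : PromiseIqThreeNotPPoly) : IqThreeNotPPoly := by
  rw [iqThreeNotPPoly_iff]
  intro hmem
  apply h
  simp only [PPoly, SIZE, Set.mem_iUnion, Set.mem_setOf_eq] at hmem
  obtain ⟨p, C, hC, hdec⟩ := hmem
  refine ⟨p, C, hC, fun d hd => ?_⟩
  rw [hdec (encodeNat d)]
  have hiff : encodeNat d ∈ iqThreeLang ↔ 3 ∣ BinaryQuadraticForm.classNumber (-(d : ℤ)) := by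
    rw [encodeNat_mem_iff]
    exact ⟨fun h' => h'.2, fun h' => ⟨hd, h'⟩⟩
  by_cases h3 : 3 ∣ BinaryQuadraticForm.classNumber (-(d : ℤ))
  · rw [decide_eq_true h3]
    exact (iqThreeLang.mem_iff_boolIndicator _).1 (hiff.2 h3)
  · rw [decide_eq_false h3]
    exact (iqThreeLang.notMem_iff_boolIndicator _).1 (fun h' => h3 (hiff.1 h'))

/-- STUB (provable, M-sized plumbing): the top rung implies the promise core. From a promise decider
`C` build the `±1` test `sgn ∘ C_n ∘ bits`; on `𝒟_n` it equals `−sgn` of `[3 ∣ h]`, so the correlation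
sum is `Σ |t − 2| ≥ #𝒟_n` by `one_le_abs_pow_three_sub_two` (`t = 3^{r₃}` by
`exists_quadFieldThreeTorsion_eq_pow` + the pinning hypothesis; `3 ∣ h ↔ t > 1` by
`three_dvd_classNumber_iff_one_lt_quadFieldThreeTorsion`), contradicting the rung at `ε = 1/2` once
`𝒟_n ≠ ∅` (needs: `encodeNat d` has length `n` and `get i = testBit d i` for `2^{n-1} ≤ d < 2^n`). -/
def TopRungStub : Prop :=
  (∀ᶠ n : ℕ in atTop, (negFundBlock n).Nonempty) → PPolyRung → PromiseIqThreeNotPPoly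

/-- Composition of the second line (kernel-checked): nonemptiness of the blocks + the P/poly rung
give the crux by name. -/
theorem iqThreeNotPPoly_of_ppolyRung (hT : TopRungStub)
    (hne : ∀ᶠ n : ℕ in atTop, (negFundBlock n).Nonempty) (hR : PPolyRung) : IqThreeNotPPoly :=
  iqThreeNotPPoly_of_promise (hT hne hR)

/-- The disprover's PRIME core implies the promise core, given polynomial-size circuits for
"prime and ≡ 3 (mod 4)" (AKS ⊆ P ⊆ P/poly; hypothesis as in `Disproof.iqThreeNotPPoly_of_prime`):
a promise decider intersected with that circuit decides `IQ3′`. STUB (provable, M-sized). -/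
def PrimeToPromiseStub : Prop :=
  encodingNatBool.toLanguage primes34Set ∈ PPoly → PrimeIqThreeNotPPoly → PromiseIqThreeNotPPoly

end Summit.QuantumAdvantage.QuantumAdvantage.Cruxes.IqThreeNotPPoly.SketchIdeator2

end
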